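import Literature.NumberTheory.ModularForms.SiegelThetaMultiplierReduction
import HarnessLib

/-!
# The theta multiplier in degree one, in classical language: `θ_Q(γτ) = χ_Q(γ)(cτ + d)^k θ_Q(τ)` for
# `γ = (a b; c d) ∈ Γ₀(q) ⊂ SL₂(ℤ)`, `χ_Q(γ) = d^k G¹(−c/d, Q)`, and (4.24) `χ_Q^n(m^{(ν)}_γ) = χ_Q(γ)`
# (Andrianov–Zhuravlev Ch. 1 Thm. 3.13 / §4.4 at `n = 1`)

Layer `Literature/NumberTheory/ModularForms`, namespace `Literature.NumberTheory.ModularForms` (lane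
`lit-hodgefound`, Layer A2, seat `lit-hodgefound-skel-2`, row A2-247; on A2-233 `SiegelThetaSeriesLevelCharacter`
(THEOREM 3.13 (3.30): `θⁿ(M⟨Z⟩, Q) = χ_Q^n(M) det(CZ + D)^{m/2} θⁿ(Z, Q)` on `Γ₀ⁿ(q)`, `siegelThetaChi`), A2-239/A2-240
(`(4.21)`, `(4.24)` on the block representatives `m^{(ν)}_γ = sl2Emb ν γ`), and p16's degree-one dictionary
`SiegelModularFormsDegreeOne` (`𝔥₁ = ℍ`: `one1`, `spOfSL γ = ((a) (b); (c) (d))`, `moeb_spOfSL` = Mathlib's `γ • τ`,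
`det_denom_spOfSL` = Mathlib's `UpperHalfPlane.denom`)). THEOREMS ONLY: no definition, no named fact.

Source: A. N. Andrianov, V. G. Zhuravlev, *Modular Forms and Hecke Operators* (Transl. Math. Monogr. 145, AMS; held
text `book:andrianov2015-modular-forms-hecke-operators`), Ch. 1 §3.3 Theorem 3.13 [p0027] and §4.4 (4.20)–(4.24),
Prop. 4.9 [p0036–p0040], READ AT `n = 1` — the classical statements about the one-variable theta series
`θ_Q(τ) = θ¹((τ), Q) = Σ_{N ∈ ℤ^m} e^{πi Q[N] τ}` of a positive even quadratic form `Q` in `m = 2k` variables of level `q`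
under `Γ₀(q) = {(a b; c d) ∈ SL₂(ℤ) : q ∣ c}`, in Mathlib's language (`SL(2, ℤ)` acting on `ℍ`, `UpperHalfPlane.denom`):

* `spOfSL_eq_coe_sl2Emb` (`spOfSL γ = m^{(0)}_γ`), `dvd_toBlocks₂₁_spOfSL`, `det_toBlocks₂₂_spOfSL` (`det D = d`);
* **`siegelThetaSeries_one1_smul`** / `toUHPFun_siegelThetaSeries_smul`: `θ_Q(γτ) = χ_Q(γ)·(cτ + d)^k·θ_Q(τ)` for
  `γ ∈ Γ₀(q)`, `τ ∈ ℍ`, with `χ_Q(γ) := χ_Q^1(spOfSL γ)` (Theorem 3.13 at `n = 1`);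
* **`siegelThetaChi_spOfSL_eq`**: (4.21) at `n = 1`, `χ_Q(γ) = d^k G¹(−c/d, Q)` (`d ≠ 0`; `G¹ = siegelGaussSum` of A2-238);
* **`siegelThetaChi_sl2Emb_eq_spOfSL`**: (4.24) with the classical right-hand side, `χ_Q^n(m^{(ν)}_γ) = χ_Q(γ)`;
* the printed special values `χ_Q(T^b) = 1` ("`χ_Q^1((1 b; 0 1)) = 1` for any `b ∈ ℤ`", Prop. 4.9's proof),
  `χ_Q((1 0; qc 1)) = 1` (the lower generators of `K`), `χ_Q(−1) = (−1)^k` ("in particular `χ_Q(−1) = (−1)^k`").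

For `m = 2` compare the lane's `BinaryThetaEmbedding` / `BinaryThetaNull` (binary theta nulls under `Γ₀(D)` through
the genus-two embedding, constant up to a unit); here `m` is any even rank and the constant is A–Z's `χ_Q`.

## References

* [AndrianovZhuravlev2015] A. N. Andrianov, V. G. Zhuravlev, *Modular Forms and Hecke Operators*, Ch. 1 §3.3 (3.28),
  Theorem 3.13 (3.30) [p0027]; §4.2 proof of Prop. 4.3 [p0033]; §4.3 (4.9)–(4.10) [p0033–p0034]; §4.4 (4.20)–(4.21),
  (4.24), Prop. 4.9 [p0036–p0040].
* [Klingen1990] H. Klingen, *Introductory Lectures on Siegel Modular Forms*, §1 (p. 12), §3 Prop. 6 (p. 39), §4 (p. 43)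
  (the degree-one dictionary and the embeddings `m^{(ν)}`; the tree's `SiegelModularFormsDegreeOne`,
  `SymplecticEmbeddedSL2Generation`).
-/

noncomputable section

open Complex Real Matrix Set
open scoped MatrixGroups UpperHalfPlane

namespace Literature.NumberTheory.ModularForms

open Literature.NumberTheory.Automorphic (siegelUpperHalfSpace)
open Literature.NumberTheory.ModularForms.SiegelUpperHalfSpace
open Literature.LinearAlgebra.Matrix.SymplecticMatrix (sl2Emb)
open SiegelModularForm (one1 spOfSL spOfSL_mem moeb_spOfSL det_denom_spOfSL one1_coe_mem toUHPFun toUHPFun_apply)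

section DegreeOne

variable {m n : ℕ} (Q : Matrix (Fin m) (Fin m) ℤ) {q : ℕ} {P : Matrix (Fin m) (Fin m) ℤ}

/-- **p16's `spOfSL γ` is Klingen's `m^{(0)}_γ` in degree one**: the `2 × 2` integral matrix attached to
`γ ∈ SL₂(ℤ)` by `1 × 1` blocks is the embedded matrix `sl2Emb 0 γ` of A2-240 (`coe_sl2Emb_fin_one`).
[cite: AndrianovZhuravlev2015, Ch. 1 §4.4 (4.24) ("χ_Q^1((α β; γ δ))") (p0039)] [cite: Klingen1990, §1 (p. 12), §3 Prop. 6 (p. 39)] -/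
theorem spOfSL_eq_coe_sl2Emb (γ : SL(2, ℤ)) :
    spOfSL γ = ((sl2Emb (0 : Fin 1) γ : Matrix.symplecticGroup (Fin 1) ℤ) : Matrix (Fin 1 ⊕ Fin 1) (Fin 1 ⊕ Fin 1) ℤ) := by
  rw [coe_sl2Emb_fin_one]
  rfl

/-- The `C`-block of `spOfSL γ` is `(c)`: `γ ∈ Γ₀(q)` iff `spOfSL γ ∈ Γ₀¹(q)`.
[cite: AndrianovZhuravlev2015, Ch. 1 §3.3 (3.28) (Γ₀ⁿ(q)) (p0027)] -/
theorem dvd_toBlocks₂₁_spOfSL {γ : SL(2, ℤ)} (hγ : (q : ℤ) ∣ γ 1 0) (i j : Fin 1) : (q : ℤ) ∣ (spOfSL γ).toBlocks₂₁ i j := by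
  rw [spOfSL, Matrix.toBlocks_fromBlocks₂₁, SiegelModularForm.one1_apply]
  exact hγ

/-- `det D = d` for `spOfSL γ`, `γ = (a b; c d)`. [cite: AndrianovZhuravlev2015, Ch. 1 §4.3 (4.9) ("det D") (p0033)] -/
theorem det_toBlocks₂₂_spOfSL (γ : SL(2, ℤ)) : (spOfSL γ).toBlocks₂₂.det = γ 1 1 := by
  rw [spOfSL, Matrix.toBlocks_fromBlocks₂₂, Matrix.det_unique, SiegelModularForm.one1_apply]

/-- **THEOREM 3.13 (3.30) in degree one, classical form: `θ_Q(γτ) = χ_Q(γ)·(cτ + d)^k·θ_Q(τ)`** for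
`Q ∈ A_m^+` even (`m = 2k`) of level `q` (`PQ = QP = q·1_m`, `P` even), `γ = (a b; c d) ∈ Γ₀(q) ⊂ SL₂(ℤ)` (`q ∣ c`)
and `τ ∈ ℍ`, where `θ_Q(τ) = θ¹((τ), Q) = Σ_{N ∈ ℤ^m} e^{πiQ[N]τ}`, `γτ = (aτ + b)/(cτ + d)` is Mathlib's action of
`SL₂(ℤ)` on `ℍ`, `cτ + d` is Mathlib's `UpperHalfPlane.denom`, and `χ_Q(γ) = χ_Q^1(spOfSL γ)` (`siegelThetaChi`).
[cite: AndrianovZhuravlev2015, Ch. 1 §3.3 Theorem 3.13 (3.30) (p0027); §4.4 (4.20) (p0036)] -/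
theorem siegelThetaSeries_one1_smul (hQ : Q.IsSymm) (hQe : ∀ i, Even (Q i i)) (hQp : (Q.map ((↑) : ℤ → ℝ)).PosDef)
    (hm : Even m) (hq : 0 < q) (hPQ : P * Q = (q : ℤ) • (1 : Matrix (Fin m) (Fin m) ℤ))
    (hQP : Q * P = (q : ℤ) • (1 : Matrix (Fin m) (Fin m) ℤ)) (hPe : ∀ i, Even (P i i))
    {γ : SL(2, ℤ)} (hγ : (q : ℤ) ∣ γ 1 0) (τ : ℍ) :
    siegelThetaSeries Q (one1 (((γ • τ : ℍ) : ℂ))) =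
      siegelThetaChi Q (spOfSL γ) * UpperHalfPlane.denom (γ : GL (Fin 2) ℝ) τ ^ (m / 2) * siegelThetaSeries Q (one1 (τ : ℂ)) := by
  rw [← moeb_spOfSL, ← det_denom_spOfSL]
  exact siegelThetaSeries_moeb_eq_chi Q hQ hQe hQp hm (Int.natCast_ne_zero.2 hq.ne') hPQ hQP hPe (spOfSL_mem γ)
    (dvd_toBlocks₂₁_spOfSL hγ) (one1_coe_mem τ)

/-- The same for the function `θ_Q = toUHPFun (θ¹(·, Q)) : ℍ → ℂ`. [cite: AndrianovZhuravlev2015, Ch. 1 §3.3 Theorem 3.13 (3.30) (p0027)] -/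
theorem toUHPFun_siegelThetaSeries_smul (hQ : Q.IsSymm) (hQe : ∀ i, Even (Q i i)) (hQp : (Q.map ((↑) : ℤ → ℝ)).PosDef)
    (hm : Even m) (hq : 0 < q) (hPQ : P * Q = (q : ℤ) • (1 : Matrix (Fin m) (Fin m) ℤ))
    (hQP : Q * P = (q : ℤ) • (1 : Matrix (Fin m) (Fin m) ℤ)) (hPe : ∀ i, Even (P i i))
    {γ : SL(2, ℤ)} (hγ : (q : ℤ) ∣ γ 1 0) (τ : ℍ) :
    toUHPFun (siegelThetaSeries Q) (γ • τ) =
      siegelThetaChi Q (spOfSL γ) * UpperHalfPlane.denom (γ : GL (Fin 2) ℝ) τ ^ (m / 2) * toUHPFun (siegelThetaSeries Q) τ := by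
  rw [toUHPFun_apply, toUHPFun_apply]
  exact siegelThetaSeries_one1_smul Q hQ hQe hQp hm hq hPQ hQP hPe hγ τ

/-- **(4.21) in degree one: `χ_Q(γ) = d^k G¹(−c/d, Q)`** for `γ = (a b; c d) ∈ Γ₀(q)`, `d ≠ 0` (automatic for
`q > 1`), `m = 2k`: the classical theta multiplier as the degree-one Gauss sum of A2-238
(`G¹(s, Q) = |d|^{−m} Σ_{l ∈ (ℤ/|d|ℤ)^m} e{Q[l]s}`). [cite: AndrianovZhuravlev2015, Ch. 1 §4.4 (4.21) (p0037); §4.3 (4.10) (p0034)] -/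
theorem siegelThetaChi_spOfSL_eq (hQ : Q.IsSymm) (hQe : ∀ i, Even (Q i i)) (hQp : (Q.map ((↑) : ℤ → ℝ)).PosDef)
    (hm : Even m) (hq : 0 < q) (hPQ : P * Q = (q : ℤ) • (1 : Matrix (Fin m) (Fin m) ℤ))
    (hQP : Q * P = (q : ℤ) • (1 : Matrix (Fin m) (Fin m) ℤ)) (hPe : ∀ i, Even (P i i))
    {γ : SL(2, ℤ)} (hγ : (q : ℤ) ∣ γ 1 0) (hδ : γ 1 1 ≠ 0) :
    siegelThetaChi Q (spOfSL γ) =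
      ((γ 1 1 : ℤ) : ℂ) ^ (m / 2) * siegelGaussSum Q (γ 1 1).natAbs (Matrix.of fun _ _ : Fin 1 => -((γ 1 0 : ℤ) : ℂ) / ((γ 1 1 : ℤ) : ℂ)) := by
  rw [spOfSL_eq_coe_sl2Emb]
  exact siegelThetaChi_sl2Emb_eq Q hQ hQe hQp hm hq hPQ hQP hPe (0 : Fin 1) hγ hδ

/-- **(4.24) with the classical right-hand side: `χ_Q^n(m^{(ν)}_γ) = χ_Q(γ)`** — the degree-`n` multiplier on the block
representatives of Lemma 4.8 is the classical degree-one theta multiplier of `γ ∈ Γ₀(q)`.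
[cite: AndrianovZhuravlev2015, Ch. 1 §4.4 (4.24) (p0039)] -/
theorem siegelThetaChi_sl2Emb_eq_spOfSL (hQ : Q.IsSymm) (hQe : ∀ i, Even (Q i i)) (hQp : (Q.map ((↑) : ℤ → ℝ)).PosDef)
    (hm : Even m) (hq : 0 < q) (hPQ : P * Q = (q : ℤ) • (1 : Matrix (Fin m) (Fin m) ℤ))
    (hQP : Q * P = (q : ℤ) • (1 : Matrix (Fin m) (Fin m) ℤ)) (hPe : ∀ i, Even (P i i))
    (ν : Fin n) {γ : SL(2, ℤ)} (hγ : (q : ℤ) ∣ γ 1 0) (hδ : γ 1 1 ≠ 0) :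
    siegelThetaChi Q ((sl2Emb ν γ : Matrix.symplecticGroup (Fin n) ℤ) : Matrix (Fin n ⊕ Fin n) (Fin n ⊕ Fin n) ℤ) =
      siegelThetaChi Q (spOfSL γ) := by
  rw [spOfSL_eq_coe_sl2Emb]
  exact siegelThetaChi_sl2Emb Q hQ hQe hQp hm hq hPQ hQP hPe ν hγ hδ

/-- **`χ_Q(T) = 1` for `T = (1 1; 0 1)`** (in degree one `spOfSL T = T(1)`): `θ_Q(τ + 1) = θ_Q(τ)`.
[cite: AndrianovZhuravlev2015, Ch. 1 §4.2 Prop. 4.3 proof ("θⁿ(M⟨Z⟩, Q) = θⁿ(Z, Q) for M = T(S)") (p0033); §4.4 Prop. 4.9 proof ("χ_Q^1((1 b; 0 1)) = 1 for any b ∈ Z") (p0039)] -/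
theorem siegelThetaChi_spOfSL_T_pow (hQ : Q.IsSymm) (hQe : ∀ i, Even (Q i i)) (hQp : (Q.map ((↑) : ℤ → ℝ)).PosDef)
    (b : ℤ) : siegelThetaChi Q (spOfSL (ModularGroup.T ^ b)) = 1 := by
  have h : spOfSL (ModularGroup.T ^ b) = Matrix.fromBlocks 1 (one1 b) 0 1 := by
    rw [spOfSL, ModularGroup.coe_T_zpow]
    congr 1 <;> ext i j <;> (obtain rfl : i = 0 := Subsingleton.elim _ _) <;>
      (obtain rfl : j = 0 := Subsingleton.elim _ _) <;> simp
  rw [h]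
  exact siegelThetaChi_translation Q hQ hQe hQp (by unfold Matrix.IsSymm; ext i j; simp)

/-- **`χ_Q((1 0; cq 1)) = 1`** — the lower translations of `Γ₀(q)` (in degree one `spOfSL = (1 0; q(c) 1)`).
[cite: AndrianovZhuravlev2015, Ch. 1 §4.4 after (4.21) (χ_Q trivial on the generators of K) (p0037)] -/
theorem siegelThetaChi_spOfSL_lower (hQ : Q.IsSymm) (hQe : ∀ i, Even (Q i i)) (hQp : (Q.map ((↑) : ℤ → ℝ)).PosDef)
    (hm : Even m) (hq : 0 < q) (hPQ : P * Q = (q : ℤ) • (1 : Matrix (Fin m) (Fin m) ℤ))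
    (hQP : Q * P = (q : ℤ) • (1 : Matrix (Fin m) (Fin m) ℤ)) (hPe : ∀ i, Even (P i i))
    {γ : SL(2, ℤ)} (ha : γ 0 0 = 1) (hb : γ 0 1 = 0) (hd : γ 1 1 = 1) (c : ℤ) (hc : γ 1 0 = q * c) :
    siegelThetaChi Q (spOfSL γ) = 1 := by
  have h : spOfSL γ = Matrix.fromBlocks 1 0 ((q : ℤ) • one1 c) 1 := by
    rw [spOfSL, ha, hb, hd, hc]
    congr 1 <;> ext i j <;> (obtain rfl : i = 0 := Subsingleton.elim _ _) <;>
      (obtain rfl : j = 0 := Subsingleton.elim _ _) <;> simp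
  rw [h]
  exact siegelThetaChi_lowerTranslation Q hQ hQe hQp hm (Int.natCast_pos.2 hq) hPQ hQP hPe
    (by unfold Matrix.IsSymm; ext i j; simp)

/-- **`χ_Q(−1) = (−1)^k`** (`spOfSL (−1) = −1_2`). [cite: AndrianovZhuravlev2015, Ch. 1 §4.4 Prop. 4.9 ("in particular χ_Q(−1) = (−1)^k") (p0039)] -/
theorem siegelThetaChi_spOfSL_neg_one (hQ : Q.IsSymm) (hQp : (Q.map ((↑) : ℤ → ℝ)).PosDef) :
    siegelThetaChi Q (spOfSL (-1)) = (-1 : ℂ) ^ (m / 2) := by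
  have h : spOfSL (-1) = (-1 : Matrix (Fin 1 ⊕ Fin 1) (Fin 1 ⊕ Fin 1) ℤ) := by
    rw [spOfSL, ← Matrix.fromBlocks_one, Matrix.fromBlocks_neg]
    congr 1 <;> ext i j <;> (obtain rfl : i = 0 := Subsingleton.elim _ _) <;>
      (obtain rfl : j = 0 := Subsingleton.elim _ _) <;> simp
  rw [h, siegelThetaChi_neg_one Q hQ hQp, one_mul]

end DegreeOne

end Literature.NumberTheory.ModularForms
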